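import Summits.RiemannHypothesis.RiemannHypothesis.Theorems.GroundBartaEvenWinsBeyondArchDeflationMajorant
import HarnessLib

/-!
# RiemannHypothesis / GroundBarta — rung 4 (`EvenWinsBeyondArch`, stmt-RiemannHypothesis-18807 / 18085):
# the deflated Temple L-side — the archimedean majorant of a LIPSCHITZ trial vector (interior support edge)

Helper file (`--supports stmt-RiemannHypothesis-18085`), RH-free, Mathlib + landed tree files only, no definitions,
no named facts.  Prover A (g10 of unit `sr-gb-rung-a`), endpoint cell `(log 5)/2` of the parity / positivity ladder.

The window-image theorem (`dt_windowImage_repr`) needs a square-integrable majorant `m` of the archimedean second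
differences `∫₀^∞ ρ(t)|2v(y) − v(y−t) − v(y+t)| dt ≤ m(y)` at EVERY `y` of the open window `(-c, c)`.  For the
certificates so far the trial vectors were `v = g·𝟙_{[-c,c]}` with the jump AT the window edge
(`dt_exists_majorant_of_contDiff`, file …DeflationMajorant).  At the endpoint cell the trial vectors are cut at a
rational `c' < c = (log 5)/2` INSIDE the window; a jump at `±c'` would make the second differences non-integrable at
`y = ±c'`, so the vectors are chosen EDGE-VANISHING, `v = g·𝟙_{[-c',c']}` with `g(±c') = 0`: then `v` is globally
Lipschitz and bounded, `|2v(y) − v(y−t) − v(y+t)| ≤ min(2Lt, 4G₀)`, and with `tρ(t) ≤ 1/2 + t/4` the majorant is a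
constant on the window:

* `dt_exists_majorant_of_lipschitz` — the majorant for any measurable, bounded, Lipschitz `v : ℝ → ℂ`;
* `dt_indicator_edgeVanishing_bounds` — `v = g·𝟙_{[-c',c']}`, `g ∈ C¹`, `g(±c') = 0`, `|g| ≤ G₀`, `|g'| ≤ L` on
  `[-c', c']` ⇒ `‖v‖ ≤ G₀` and `‖v(a) − v(b)‖ ≤ L|a − b|` (the vector is `g ∘ proj_{[-c',c']}`).
-/

set_option linter.dupNamespace false

noncomputable section

open MeasureTheory Set Filter
open scoped Topology ENNReal NNReal

namespace Summit.RiemannHypothesis.RiemannHypothesis.Theorems.EvenWinsBeyondArch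

open Literature.NumberTheory.LFunctions
open Summit.RiemannHypothesis.RiemannHypothesis.Theorems.WeilParity.EvenWinsArch (mul_weilArchDensity_le)

/-- **Archimedean majorant for a bounded Lipschitz vector.**  For a window `(-c, c)` and `v : ℝ → ℂ` measurable with
`‖v‖ ≤ G₀` and `‖v(a) − v(b)‖ ≤ L|a − b|`, there is `m ∈ L²(ℝ)` (a constant on `(-c, c)`, zero outside) such that
for every `y ∈ (-c, c)` the archimedean second differences `t ↦ ρ(t)|2v(y) − v(y−t) − v(y+t)|` are integrable on
`(0, ∞)` with integral `≤ m(y)`:  `|2v(y) − v(y−t) − v(y+t)| ≤ 2Lt` and `tρ(t) ≤ 1/2 + t/4` on `(0, 1)`, and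
`≤ 4G₀` against `∫_1^∞ ρ` beyond. [folklore] -/
theorem dt_exists_majorant_of_lipschitz (c : ℝ) {v : ℝ → ℂ} (hvm : Measurable v)
    {G₀ L : ℝ} (hG₀ : ∀ z, ‖v z‖ ≤ G₀) (hL : ∀ a b, ‖v a - v b‖ ≤ L * |a - b|) :
    ∃ m : ℝ → ℝ, MemLp m 2 volume ∧
      (∀ y ∈ Ioo (-c) c,
        IntegrableOn (fun t ↦ weilArchDensity t * ‖2 * v y - v (y - t) - v (y + t)‖) (Ioi 0)) ∧
      (∀ y ∈ Ioo (-c) c,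
        ∫ t in Ioi 0, weilArchDensity t * ‖2 * v y - v (y - t) - v (y + t)‖ ≤ m y) := by
  have hG₀0 : 0 ≤ G₀ := (norm_nonneg _).trans (hG₀ 0)
  have hL0 : 0 ≤ L := by
    have h := hL 1 0
    rw [sub_zero, abs_one, mul_one] at h
    exact (norm_nonneg _).trans h
  set C₁ : ℝ := ∫ t in Ici (1 : ℝ), weilArchDensity t with hC₁
  have hC₁0 : 0 ≤ C₁ :=
    setIntegral_nonneg measurableSet_Ici fun t (ht : 1 ≤ t) ↦ (weilArchDensity_pos (by linarith)).le
  set K : ℝ := 3 * L / 2 + 4 * G₀ * C₁ with hK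
  have hK0 : 0 ≤ K := by positivity
  -- the majorant: the constant `K` on the window
  set m : ℝ → ℝ := (Ioo (-c) c).indicator fun _ ↦ K with hm
  -- pointwise bounds on the second differences
  have hsmall : ∀ y t, 0 ≤ t → ‖2 * v y - v (y - t) - v (y + t)‖ ≤ 2 * L * t := by
    intro y t ht
    have e : 2 * v y - v (y - t) - v (y + t) = (v y - v (y - t)) + (v y - v (y + t)) := by ring
    rw [e]
    have h1 := hL y (y - t)
    have h2 := hL y (y + t)
    rw [show y - (y - t) = t by ring, abs_of_nonneg ht] at h1
    rw [show y - (y + t) = -t by ring, abs_neg, abs_of_nonneg ht] at h2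
    calc ‖(v y - v (y - t)) + (v y - v (y + t))‖ ≤ ‖v y - v (y - t)‖ + ‖v y - v (y + t)‖ := norm_add_le _ _
      _ ≤ L * t + L * t := add_le_add h1 h2
      _ = 2 * L * t := by ring
  have hlarge : ∀ y t, ‖2 * v y - v (y - t) - v (y + t)‖ ≤ 4 * G₀ := by
    intro y t
    calc ‖2 * v y - v (y - t) - v (y + t)‖ ≤ ‖2 * v y - v (y - t)‖ + ‖v (y + t)‖ := norm_sub_le _ _
      _ ≤ ‖2 * v y‖ + ‖v (y - t)‖ + ‖v (y + t)‖ := by linarith [norm_sub_le (2 * v y) (v (y - t))]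
      _ ≤ 2 * G₀ + G₀ + G₀ := by
          rw [norm_mul, Complex.norm_ofNat]
          linarith [hG₀ y, hG₀ (y - t), hG₀ (y + t)]
      _ = 4 * G₀ := by ring
  -- the dominating function (independent of `y`)
  set H : ℝ → ℝ := fun t ↦ (Ioo 0 1).indicator (fun _ ↦ 3 * L / 2) t +
    (Ici 1).indicator (fun t ↦ 4 * G₀ * weilArchDensity t) t with hH
  have hvol0 : volume (Ioo (0 : ℝ) 1) ≠ ⊤ := by rw [Real.volume_Ioo]; exact ENNReal.ofReal_ne_top
  have iA : IntegrableOn (fun _ : ℝ ↦ 3 * L / 2) (Ioo 0 1) := integrableOn_const hvol0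
  have iR : IntegrableOn (fun t ↦ 4 * G₀ * weilArchDensity t) (Ici 1) :=
    (dt_integrableOn_weilArchDensity_Ici one_pos).const_mul _
  have i1 : IntegrableOn (fun t ↦ (Ioo 0 1).indicator (fun _ ↦ 3 * L / 2) t) (Ioi (0 : ℝ)) :=
    (iA.integrable_indicator measurableSet_Ioo).integrableOn
  have i2 : IntegrableOn (fun t ↦ (Ici 1).indicator (fun t ↦ 4 * G₀ * weilArchDensity t) t) (Ioi (0 : ℝ)) :=
    (iR.integrable_indicator measurableSet_Ici).integrableOn
  have hHint : IntegrableOn H (Ioi 0) := i1.add i2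
  have hHval : ∫ t in Ioi 0, H t = K := by
    have e1 : ∫ t in Ioi (0 : ℝ), (Ioo (0 : ℝ) 1).indicator (fun _ ↦ 3 * L / 2) t = 3 * L / 2 := by
      rw [integral_indicator measurableSet_Ioo, Measure.restrict_restrict measurableSet_Ioo,
        inter_eq_left.2 (Ioo_subset_Ioi_self : Ioo (0 : ℝ) 1 ⊆ Ioi 0), setIntegral_const, Measure.real,
        Real.volume_Ioo, sub_zero, ENNReal.toReal_ofReal zero_le_one, smul_eq_mul, one_mul]
    have e2 : ∫ t in Ioi (0 : ℝ), (Ici (1 : ℝ)).indicator (fun t ↦ 4 * G₀ * weilArchDensity t) t =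
        4 * G₀ * C₁ := by
      rw [integral_indicator measurableSet_Ici, Measure.restrict_restrict measurableSet_Ici,
        inter_eq_left.2 (Ici_subset_Ioi.2 one_pos), integral_const_mul]
    show ∫ t in Ioi (0 : ℝ), ((Ioo (0 : ℝ) 1).indicator (fun _ ↦ 3 * L / 2) t +
      (Ici (1 : ℝ)).indicator (fun t ↦ 4 * G₀ * weilArchDensity t) t) = K
    rw [integral_add i1 i2, e1, e2]
  have hdom : ∀ y, ∀ t ∈ Ioi (0 : ℝ), weilArchDensity t * ‖2 * v y - v (y - t) - v (y + t)‖ ≤ H t := by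
    intro y t (ht : 0 < t)
    have hρ := (weilArchDensity_pos ht).le
    by_cases ht1 : t < 1
    · have h1 : weilArchDensity t * ‖2 * v y - v (y - t) - v (y + t)‖ ≤ 3 * L / 2 := by
        calc weilArchDensity t * ‖2 * v y - v (y - t) - v (y + t)‖
            ≤ weilArchDensity t * (2 * L * t) := mul_le_mul_of_nonneg_left (hsmall y t ht.le) hρ
          _ = (t * weilArchDensity t) * (2 * L) := by ring
          _ ≤ (1 / 2 + t / 4) * (2 * L) := mul_le_mul_of_nonneg_right (mul_weilArchDensity_le ht) (by positivity)
          _ ≤ (1 / 2 + 1 / 4) * (2 * L) := by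
              refine mul_le_mul_of_nonneg_right ?_ (by positivity); linarith
          _ = 3 * L / 2 := by ring
      have h2 : 3 * L / 2 ≤ H t := by
        rw [hH]
        simp only [indicator_of_mem (show t ∈ Ioo (0 : ℝ) 1 from ⟨ht, ht1⟩)]
        have : 0 ≤ (Ici (1 : ℝ)).indicator (fun t ↦ 4 * G₀ * weilArchDensity t) t := by
          by_cases h : t ∈ Ici (1 : ℝ)
          · rw [indicator_of_mem h]; exact mul_nonneg (by positivity) hρ
          · rw [indicator_of_notMem h]
        linarith
      exact h1.trans h2
    · have h1 : weilArchDensity t * ‖2 * v y - v (y - t) - v (y + t)‖ ≤ 4 * G₀ * weilArchDensity t := by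
        calc weilArchDensity t * ‖2 * v y - v (y - t) - v (y + t)‖
            ≤ weilArchDensity t * (4 * G₀) := mul_le_mul_of_nonneg_left (hlarge y t) hρ
          _ = 4 * G₀ * weilArchDensity t := by ring
      have h2 : 4 * G₀ * weilArchDensity t ≤ H t := by
        rw [hH]
        simp only [indicator_of_mem (show t ∈ Ici (1 : ℝ) from not_lt.1 ht1)]
        have : 0 ≤ (Ioo (0 : ℝ) 1).indicator (fun _ ↦ 3 * L / 2) t := by
          by_cases h : t ∈ Ioo (0 : ℝ) 1
          · rw [indicator_of_mem h]; positivity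
          · rw [indicator_of_notMem h]
        linarith
      exact h1.trans h2
  have hint : ∀ y, IntegrableOn (fun t ↦ weilArchDensity t * ‖2 * v y - v (y - t) - v (y + t)‖) (Ioi 0) := by
    intro y
    have hmeas : AEStronglyMeasurable (fun t ↦ weilArchDensity t * ‖2 * v y - v (y - t) - v (y + t)‖)
        (volume.restrict (Ioi 0)) := by
      refine (measurable_weilArchDensity.mul ?_).aestronglyMeasurable.restrict
      exact ((measurable_const.sub (hvm.comp (measurable_const.sub measurable_id))).sub
        (hvm.comp (measurable_const.add measurable_id))).norm
    exact Integrable.mono' hHint hmeas ((ae_restrict_iff' measurableSet_Ioi).2 (Eventually.of_forall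
      fun t ht ↦ by
        rw [Real.norm_of_nonneg (mul_nonneg (weilArchDensity_pos ht).le (norm_nonneg _))]
        exact hdom y t ht))
  refine ⟨m, ?_, fun y _ ↦ hint y, fun y hy ↦ ?_⟩
  · have hvol : volume (Ioo (-c) c) ≠ ⊤ := by rw [Real.volume_Ioo]; exact ENNReal.ofReal_ne_top
    exact memLp_indicator_const 2 measurableSet_Ioo _ (Or.inr hvol)
  · rw [hm, indicator_of_mem hy, ← hHval]
    exact setIntegral_mono_on (hint y) hHint measurableSet_Ioi (hdom y)

/-- **An edge-vanishing `C¹ × indicator` vector is bounded and Lipschitz.**  For `0 < c'`, `g ∈ C¹(ℝ)` with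
`g(c') = g(-c') = 0`, `|g| ≤ G₀` and `|g'| ≤ L` on `[-c', c']`, the vector `v = g·𝟙_{[-c',c']}` (cast to `ℂ`)
satisfies `‖v‖ ≤ G₀` and `‖v(a) − v(b)‖ ≤ L|a − b|` for all real `a, b` (it is `g ∘ proj_{[-c',c']}`, and the
projection is `1`-Lipschitz). [folklore] -/
theorem dt_indicator_edgeVanishing_bounds {c' : ℝ} (hc' : 0 < c') {g : ℝ → ℝ} (hg : ContDiff ℝ 1 g)
    (hg1 : g c' = 0) (hg2 : g (-c') = 0) {G₀ L : ℝ} (hG₀ : ∀ z ∈ Icc (-c') c', |g z| ≤ G₀)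
    (hL : ∀ z ∈ Icc (-c') c', |deriv g z| ≤ L)
    {v : ℝ → ℂ} (hv : ∀ y, v y = (((Icc (-c') c').indicator g y : ℝ) : ℂ)) :
    (∀ z, ‖v z‖ ≤ G₀) ∧ (∀ a b, ‖v a - v b‖ ≤ L * |a - b|) := by
  have hG₀0 : 0 ≤ G₀ := (abs_nonneg _).trans (hG₀ 0 ⟨by linarith, by linarith⟩)
  -- the projection onto `[-c', c']`
  set p : ℝ → ℝ := fun a ↦ max (-c') (min c' a) with hp
  have hpI : ∀ a, p a ∈ Icc (-c') c' := fun a ↦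
    ⟨le_max_left _ _, max_le (by linarith) (min_le_left _ _)⟩
  have hvp : ∀ a, v a = ((g (p a) : ℝ) : ℂ) := by
    intro a
    rw [hv a]
    by_cases ha : a ∈ Icc (-c') c'
    · rw [indicator_of_mem ha]
      have : p a = a := by
        rw [hp]; simp only
        rw [min_eq_right ha.2, max_eq_right ha.1]
      rw [this]
    · rw [indicator_of_notMem ha]
      rcases lt_or_ge c' a with h | h
      · have : p a = c' := by
          rw [hp]; simp only
          rw [min_eq_left h.le, max_eq_right (by linarith)]
        rw [this, hg1]
      · have h' : a < -c' := by
          by_contra hh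
          exact ha ⟨not_lt.1 hh, h⟩
        have : p a = -c' := by
          rw [hp]; simp only
          rw [min_eq_right (by linarith), max_eq_left h'.le]
        rw [this, hg2]
  have hplip : ∀ a b, |p a - p b| ≤ |a - b| := by
    intro a b
    calc |p a - p b| = |max (-c') (min c' a) - max (-c') (min c' b)| := rfl
      _ ≤ max |(-c') - (-c')| |min c' a - min c' b| := abs_max_sub_max_le_max _ _ _ _
      _ = |min c' a - min c' b| := by rw [sub_self, abs_zero, max_eq_right (abs_nonneg _)]
      _ ≤ max |c' - c'| |a - b| := abs_min_sub_min_le_max _ _ _ _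
      _ = |a - b| := by rw [sub_self, abs_zero, max_eq_right (abs_nonneg _)]
  -- mean value theorem on the window
  have hmvt : ∀ x ∈ Icc (-c') c', ∀ y ∈ Icc (-c') c', ‖g y - g x‖ ≤ L * ‖y - x‖ := fun x hx y hy ↦
    Convex.norm_image_sub_le_of_norm_deriv_le (fun z _ ↦ hg.differentiable (by norm_num) z)
      (fun z hz ↦ by rw [Real.norm_eq_abs]; exact hL z hz) (convex_Icc _ _) hx hy
  refine ⟨fun z ↦ ?_, fun a b ↦ ?_⟩
  · rw [hvp z, Complex.norm_real, Real.norm_eq_abs]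
    exact hG₀ _ (hpI z)
  · rw [hvp a, hvp b, ← Complex.ofReal_sub, Complex.norm_real]
    calc ‖g (p a) - g (p b)‖ ≤ L * ‖p a - p b‖ := hmvt (p b) (hpI b) (p a) (hpI a)
      _ ≤ L * |a - b| := by
          rw [Real.norm_eq_abs]
          have hL0 : 0 ≤ L := (abs_nonneg _).trans (hL 0 ⟨by linarith, by linarith⟩)
          exact mul_le_mul_of_nonneg_left (hplip a b) hL0

/-- Measurability of a `C¹ × indicator` vector (cast to `ℂ`). [folklore] -/
theorem dt_indicator_measurable {c' : ℝ} {g : ℝ → ℝ} (hg : Continuous g)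
    {v : ℝ → ℂ} (hv : ∀ y, v y = (((Icc (-c') c').indicator g y : ℝ) : ℂ)) : Measurable v := by
  have e : v = fun y ↦ (((Icc (-c') c').indicator g y : ℝ) : ℂ) := funext hv
  rw [e]
  exact Complex.measurable_ofReal.comp ((hg.measurable).indicator measurableSet_Icc)

end Summit.RiemannHypothesis.RiemannHypothesis.Theorems.EvenWinsBeyondArch

end
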